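import Mathlib
import Summits.ValiantsHypothesis.ValiantsHypothesis.Theorems.NewtonUnitEquationsDissociatedUniformTotalsLawUnion
import Summits.ValiantsHypothesis.ValiantsHypothesis.Theorems.NewtonUnitEquationsDissociatedUniformTotalsLawConvexUnionSharpness
import Summits.ValiantsHypothesis.ValiantsHypothesis.Theorems.NewtonUnitEquationsDissociatedUniformTotalsLawUnionVertLower
import HarnessLib

/-!
# Crux `NewtonUnitEquations.DissociatedUniform` (stmt-ValiantsHypothesis-5905): the pointwise union bound for INTERVAL position
# sets — the located heir of the refuted rung `UnionVertBound`

`UnionVertBound C` (`#vert conv U_s(Z) ≤ C·|G|` for ALL position sets) is false for every `C` (`not_unionVertBound`,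
`…TotalsLawUnionVertLower`): the refuting family uses as position set an ANTI-PARABOLA of `ℤ/k × ℤ/K`, chosen so that every translate
of it is a rich LINE of a projective grid.  That mechanism needs translates that pairwise share `≤ 1` point; it is unavailable for
the structured position sets the union/`n = 3` programme actually meets next — INTERVALS of a cyclic group (memo NOTES-t1g12 §6(iii):
the located test for `UnionTotalsLaw` is `Z = [0, m)`): consecutive cyclic windows share `m − 1` labels.  This file types the
located heir:
* `cycInterval q t m = {t, t+1, …, t+m−1} ⊆ ℤ/q`;
* `@[conjecture] IntervalUnionVertBound C` : for all `q`, all `a b : ℤ/q → ℝ²`, all `t m s`,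
  `#vert conv U_s([t, t+m)) ≤ C·q`.  OPEN; asserted nowhere.  LOCATED: `C ≥ 3` is necessary (`not_intervalUnionVertBound_two`: the
  `ℤ/4` census parabolas with the interval `{0,1,2}`, `9 > 8`); census of NOTES-t1g11 (`q ≤ 16`, all `Z`): never above `3q`;
  NOTES-t1g13 §7: in the tiny-`B` regime `#vert ≤ q + E`, `E` = number of distinct chords that are hull edges of some cyclic
  window `b([t, t+m))`, and `E/q ≤ 3.9` for projective grids in four reading orders, spirals, convex permutations, random sets
  (`q ≤ 729`) and under annealing (`q ≤ 40`) — located value `C = 5`; the worst case of `E` (sliding-window hull) is open (one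
  label can re-enter the window hull `Θ(m)` times).
* sanity: `intervalUnionVertBound_of_le` (intervals of length `≤ C` are trivial), `not_intervalUnionVertBound_two`.
Honest label: a located conjecture-grade statement; `UnionTotalsLaw`, `TotalsLawThree` remain OPEN; nothing here bears on VP ≠ VNP.
[folklore]
-/

set_option linter.dupNamespace false -- `ValiantsHypothesis.ValiantsHypothesis` (summit = problem) in every name

namespace Summit.ValiantsHypothesis.ValiantsHypothesis.Theorems.NewtonUnitEquationsDissociatedUniform

namespace TotalsLaw

/-- The cyclic interval `{t, t+1, …, t+m−1}` of `ℤ/q` (as residues of the naturals `t + i`, `i < m`). -/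
def cycInterval (q t m : ℕ) : Finset (ZMod q) := (Finset.range m).image fun i : ℕ => ((t + i : ℕ) : ZMod q)

/-- A cyclic interval of length `m` has at most `m` elements. -/
theorem card_cycInterval_le (q t m : ℕ) : (cycInterval q t m).card ≤ m :=
  Finset.card_image_le.trans (Finset.card_range m).le

/-- **The pointwise union vertex bound for interval position sets** (conjecture-grade, OPEN; located `3 ≤ C`, census value `5`):
for every `q`, all `a b : ℤ/q → ℝ²`, every cyclic interval `Z = [t, t+m)` and every class `s`, `#vert conv U_s(Z) ≤ C·q`.  The
anti-parabola position sets refuting the unrestricted rung (`not_unionVertBound`) are not intervals.  Not asserted anywhere. -/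
@[conjecture] def IntervalUnionVertBound (C : ℕ) : Prop :=
  ∀ (q : ℕ) [NeZero q] (a b : ZMod q → (Fin 2 → ℝ)) (t m : ℕ) (s : ZMod q),
    unionVert a b (cycInterval q t m : Set (ZMod q)) s ≤ C * q

/-- Monotonicity in the constant. -/
theorem intervalUnionVertBound_mono {C C' : ℕ} (hCC' : C ≤ C') (h : IntervalUnionVertBound C) :
    IntervalUnionVertBound C' :=
  fun q _ a b t m s => (h q a b t m s).trans (Nat.mul_le_mul_right _ hCC')

/-- The refuted unrestricted rung contains the interval rung (so nothing is lost by restricting). -/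
theorem intervalUnionVertBound_of_unionVertBound {C : ℕ} (h : UnionVertBound C) : IntervalUnionVertBound C := by
  intro q _ a b t m s
  simpa [ZMod.card] using h (ZMod q) a b (cycInterval q t m : Set (ZMod q)) s

/-- Trivial instances: intervals of length `≤ C` (`#vert conv U_s(Z) ≤ |Z|·q`). -/
theorem intervalUnionVertBound_of_le {C : ℕ} {q : ℕ} [NeZero q] (a b : ZMod q → (Fin 2 → ℝ)) (t m : ℕ) (hm : m ≤ C)
    (s : ZMod q) : unionVert a b (cycInterval q t m : Set (ZMod q)) s ≤ C * q := by
  have h := unionVert_le_card_mul a b (cycInterval q t m) s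
  rw [ZMod.card] at h
  exact h.trans (Nat.mul_le_mul_right _ ((card_cycInterval_le q t m).trans hm))

/-- The `ℤ/4` census position set `{0, 1, 2}` is the cyclic interval `[0, 3)`. -/
theorem cycInterval_four : cycInterval 4 0 3 = CexFour.posZ := by decide

/-- **`C ≥ 3` is necessary**: `¬ IntervalUnionVertBound 2` (the `ℤ/4` census parabolas with the interval `{0,1,2}` have `9 > 8 = 2q`
hull vertices, `CexFour.nine_le_unionVert`). -/
theorem not_intervalUnionVertBound_two : ¬ IntervalUnionVertBound 2 := by
  intro h
  have h8 := h 4 CexFour.pA CexFour.pB 0 3 2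
  rw [cycInterval_four] at h8
  have h9 := CexFour.nine_le_unionVert
  omega

/-- Hence `3 ≤ C` for any valid constant. -/
theorem three_le_of_intervalUnionVertBound {C : ℕ} (h : IntervalUnionVertBound C) : 3 ≤ C := by
  by_contra hC
  exact not_intervalUnionVertBound_two (intervalUnionVertBound_mono (by omega) h)

end TotalsLaw

end Summit.ValiantsHypothesis.ValiantsHypothesis.Theorems.NewtonUnitEquationsDissociatedUniform
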